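import Mathlib
import HarnessLib
import Summits.ValiantsHypothesis.ValiantsHypothesis.Theorems.KPlusLogSqLawWeakLiftingTowerGraftInflectionLawSizeOne
import Summits.ValiantsHypothesis.ValiantsHypothesis.Theorems.LacunarySymmetroidMatrixDescartesFiniteSectorRowOne

/-!
# Tower graft line — CONJECTURE W IS THE DEVELOPABLE CONJECTURE: the double-root dictionary, the plane (not the basis),
# and the chambers where `Z₊(W(u,v)) ≤ 2K − 4` is already a theorem (dense / arithmetic supports, `K ≤ 3`)

Helper file for LINE (B) `Cruxes/WeakLifting/Lines/tower_graft.lean` (crux `WeakLifting` = stmt-ValiantsHypothesis-19561; rung S4b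
`TowerGraftLawCorner` via hand g8's inflection class law, whose size-one sector is hand g9's CONJECTURE W:
«`Z₊(W(u,v)) ≤ 2K − 4` for two real `K`-nomials `u, v` on a common support», `…InflectionLawSizeOne` §2 /
`…WronskianNonNesting`).  NO stub is claimed; nothing here bounds the general case.

WHAT THIS FILE RECORDS (hand g10).

§1 **The double-root dictionary** (`wronskian_eval_eq_zero_iff_exists_double_root`, `…_iff_one_lt_rootMultiplicity`,
`X_mul_wronskian_fewnomial_eval_eq_zero_iff`): `W(u,v)(x) = 0` iff some member `αu + βv ≠ 0·u + 0·v` of the PENCIL has a double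
root at `x`; for fewnomials `u = Σ uₗ X^{dₗ}`, `v = Σ vₗ X^{dₗ}` and `x ≠ 0` this says: some nonzero functional `c = α·u + β·v` of the
coefficient pencil kills both the point `γ(x) = (x^{dₗ})ₗ` of the LACUNARY MOMENT CURVE and its Euler tangent `θγ(x) = (dₗ x^{dₗ})ₗ`,
i.e. the tangent line of `γ` at `x` meets the codimension-2 subspace `ker u ∩ ker v`.  Hence `Z₊(W(u,v))` is the number of tangent
lines of the convex arc `γ : (0,∞) → P^{K−1}` meeting a fixed projective `(K−3)`-plane, and Conjecture W is LITERALLY the case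
`k = 1`, `n = K − 1` of the «CONJECTURE ON THE k-TH DEVELOPABLE» of V. Sedykh and B. Shapiro [cite: SedykhShapiro2005, §1:
«a curve γ : S¹ → Pⁿ is convex iff the degree of its k-th developable equals (k+1)(n−k)»; Theorem A proves n = 3, i.e. K = 4, for
CLOSED convex curves; doi:10.1142/s0129167x05003260, arXiv:math/0208218] restricted to lacunary moment arcs (convex = every
hyperplane section `Σ cₗ x^{dₗ}` has `≤ K − 1` positive zeros, Descartes).  By projective duality (`γ*` is the moment arc of the
reflected support) it is equally the case `k = n − 2` («developable hypersurface has degree 2n − 2»).  Status located by this hand: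
open for `n ≥ 4` in the cited paper; the arc (non-closed) version of Theorem A is not stated there.

§2 **The plane, not the basis** (`wronskian_pencil_pencil`, `roots_wronskian_pencil_pencil`): `W(αu+βv, γu+δv) = (αδ − βγ)·W(u,v)`,
so `Z₊` is an invariant of the 2-plane `span(u,v)` (the point of the Grassmannian `Gr(2,K)`, dimension `2K − 4 =` the conjectured
bound).

§3 **Chambers where Conjecture W is a theorem.**  (a) DENSE DEGREE: `deg u, deg v ≤ n ⇒ deg W(u,v) ≤ 2n − 2` (the top
coefficients cancel; `natDegree_wronskian_le_two_mul_sub_two`), so on the dense support `dₗ = l` two `K`-nomials have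
`Z₊(W) ≤ #roots ≤ 2K − 4` (`card_posRoots_wronskian_dense_le`); (b) ARITHMETIC supports `dₗ = e + λ·l` reduce to (a) by
`u = X^e·ũ(X^λ)`: `X·W(u,v) = λ·X^{2e+λ}·W(ũ,ṽ)(X^λ)` and `x ↦ x^λ` is injective on `(0,∞)` (`card_posRoots_wronskian_arith_le`);
(c) `K ≤ 3`: the rank-one Descartes ceiling `C(K,2) − 1` of `…InflectionLawSizeOne` already equals `2K − 4`
(`card_posRoots_wronskian_fewnomial_le_of_le_three`).

§4 **The sumset chamber** (`support_X_mul_wronskian_subset_pairSums`, `card_posRoots_wronskian_le_card_pairSums_sub_one`): the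
support of `X·W(u,v)` lies in the restricted sumset `d ∔ d = {dₐ + d_b : a < b}`, so `Z₊(W(u,v)) ≤ #(d ∔ d) − 1` — Conjecture W holds
on every support with `#(d ∔ d) ≤ 2K − 3` (arithmetic progressions are the Freiman-extremal case), in particular on every BALANCED
`4`-support `d₀ + d₃ = d₁ + d₂` (`card_posRoots_wronskian_le_four_of_balanced`).  The first support NOT decided by Descartes is an
unbalanced `4`-support (e.g. the `2`-tower `(0,1,3,20)`: six distinct pair sums, ceiling `5`, conjectured `4` = Theorem A's count).

§5 **The Euler pencil** (`X_mul_inflection_one_eval_eq_zero_iff`): §1 for `v = θg` — the size-one inflections of `g` (zeros of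
`W(g, θg)`) are the double roots of the members `α·g + β·θg = Σ sₗ(α + β dₗ)X^{dₗ}` of the Euler pencil, fewnomials on the SAME support.

HONEST FRAMING: a dictionary and three Descartes/degree-trivial chambers; nothing on S4/S4b/S4d/S4f/S5/S5ᴸ, TowerB, `WeakLifting`,
Conjecture B, `MatrixDescartes` (18050) or `VP ≠ VNP`; Conjecture W itself is NOT proved here and is (a special case of) a published
OPEN conjecture.  Def-free; Mathlib + the tree's `…InflectionLawSizeOne` (pair-sum form, Descartes ceiling).  Seat: prover
leafhand-val-kpluslogsqlaw-1 g10, `--supports stmt-ValiantsHypothesis-19561 --as helper`.  [folklore: `W(u,v)(x) = 0` iff the pencil has a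
double root at `x` (e.g. Karp, Selecta Math. 30 (2024), §1, arXiv:2110.02301, third remark); degree of the Wronskian of polynomials of
degree ≤ n; the identification with the developable conjecture and the kernel forms are this work]
-/

-- `Summit.ValiantsHypothesis.ValiantsHypothesis.…` repeats a component by the D-0017 layout
-- (single-conjunct summit), which the `dupNamespace` linter flags; the name is mandated.
set_option linter.dupNamespace false
set_option autoImplicit false

namespace Summit.ValiantsHypothesis.ValiantsHypothesis.Theorems.KPlusLogSqLaw.TowerGraft

open Polynomial Finset
open scoped BigOperators Polynomial

namespace WronskianDevelopable

/-! ## §1 The double-root dictionary -/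

/-- the pencil member `α·u + β·v` evaluated. [folklore] -/
theorem eval_pencil (u v : ℝ[X]) (a b x : ℝ) :
    (C a * u + C b * v).eval x = a * u.eval x + b * v.eval x := by
  simp

/-- the derivative of the pencil member `α·u + β·v` evaluated. [folklore] -/
theorem eval_derivative_pencil (u v : ℝ[X]) (a b x : ℝ) :
    (derivative (C a * u + C b * v)).eval x = a * (derivative u).eval x + b * (derivative v).eval x := by
  simp

/-- **The double-root dictionary.**  `W(u,v)(x) = 0` iff some member `α·u + β·v`, `(α,β) ≠ (0,0)`, of the pencil vanishes at `x`
together with its derivative (the `2 × 2` system `[[u(x), v(x)], [u′(x), v′(x)]]·(α,β)ᵀ = 0` has a nonzero solution iff its determinant,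
`W(u,v)(x)`, vanishes). [folklore; kernel form this work] -/
theorem wronskian_eval_eq_zero_iff_exists_double_root (u v : ℝ[X]) (x : ℝ) :
    (wronskian u v).eval x = 0 ↔
      ∃ c : ℝ × ℝ, c ≠ 0 ∧ (C c.1 * u + C c.2 * v).eval x = 0 ∧ (derivative (C c.1 * u + C c.2 * v)).eval x = 0 := by
  simp only [eval_pencil, eval_derivative_pencil, InflectionLaw.eval_wronskian]
  constructor
  · intro hW
    by_cases h1 : (v.eval x, -u.eval x) ≠ (0 : ℝ × ℝ)
    · refine ⟨(v.eval x, -u.eval x), h1, by ring, by linear_combination -hW⟩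
    · have hv : v.eval x = 0 := by
        by_contra hne; exact h1 (fun h => hne (Prod.mk.inj h).1)
      have hu : u.eval x = 0 := by
        by_contra hne; exact h1 (fun h => hne (neg_eq_zero.mp (Prod.mk.inj h).2))
      by_cases h2 : ((derivative v).eval x, -(derivative u).eval x) ≠ (0 : ℝ × ℝ)
      · refine ⟨((derivative v).eval x, -(derivative u).eval x), h2, by rw [hu, hv]; ring, by ring⟩
      · refine ⟨(1, 0), by simp, by rw [hu]; ring, ?_⟩
        have hdv : (derivative u).eval x = 0 := by
          by_contra hne; exact h2 (fun h => hne (neg_eq_zero.mp (Prod.mk.inj h).2))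
        rw [hdv]; ring
  · rintro ⟨c, hc, h0, h1⟩
    by_contra hW
    apply hc
    have hc1 : c.1 * (u.eval x * (derivative v).eval x - (derivative u).eval x * v.eval x) = 0 := by
      linear_combination (derivative v).eval x * h0 - v.eval x * h1
    have hc2 : c.2 * (u.eval x * (derivative v).eval x - (derivative u).eval x * v.eval x) = 0 := by
      linear_combination -(derivative u).eval x * h0 + u.eval x * h1
    have h1' : c.1 = 0 := by
      rcases mul_eq_zero.mp hc1 with h | h
      · exact h
      · exact absurd h hW
    have h2' : c.2 = 0 := by
      rcases mul_eq_zero.mp hc2 with h | h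
      · exact h
      · exact absurd h hW
    exact Prod.ext h1' h2'

/-- root-multiplicity phrasing: `W(u,v)(x) = 0` iff some NONZERO pencil member has a root of multiplicity `≥ 2` at `x`, or the
pencil degenerates at `x` (some `(α,β) ≠ 0` with `α·u + β·v = 0`, i.e. `u`, `v` linearly dependent). [folklore; Mathlib
`one_lt_rootMultiplicity_iff_isRoot`] -/
theorem wronskian_eval_eq_zero_iff_one_lt_rootMultiplicity (u v : ℝ[X]) (x : ℝ) :
    (wronskian u v).eval x = 0 ↔
      ∃ c : ℝ × ℝ, c ≠ 0 ∧ (C c.1 * u + C c.2 * v = 0 ∨ 1 < (C c.1 * u + C c.2 * v).rootMultiplicity x) := by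
  rw [wronskian_eval_eq_zero_iff_exists_double_root]
  constructor
  · rintro ⟨c, hc, h0, h1⟩
    refine ⟨c, hc, ?_⟩
    by_cases hp : C c.1 * u + C c.2 * v = 0
    · exact Or.inl hp
    · exact Or.inr ((one_lt_rootMultiplicity_iff_isRoot hp).mpr ⟨h0, h1⟩)
  · rintro ⟨c, hc, h⟩
    refine ⟨c, hc, ?_⟩
    rcases h with hp | hm
    · simp only [hp, derivative_zero, eval_zero, and_self]
    · have hp : C c.1 * u + C c.2 * v ≠ 0 := by
        intro hp; rw [hp, rootMultiplicity_zero] at hm; exact Nat.not_lt_zero 1 hm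
      obtain ⟨h0, h1⟩ := (one_lt_rootMultiplicity_iff_isRoot hp).mp hm
      exact ⟨h0, h1⟩

/-- the pencil of two fewnomials on a common support is the fewnomial of the coefficient pencil. [folklore] -/
theorem pencil_fewnomial_eq {K : ℕ} (u v : Fin K → ℝ) (d : Fin K → ℕ) (a b : ℝ) :
    C a * (∑ l, C (u l) * X ^ d l) + C b * (∑ l, C (v l) * X ^ d l) =
      ∑ l, C (a * u l + b * v l) * (X : ℝ[X]) ^ d l := by
  rw [Finset.mul_sum, Finset.mul_sum, ← Finset.sum_add_distrib]
  refine Finset.sum_congr rfl fun l _ => ?_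
  simp only [map_add, map_mul]
  ring

/-- evaluation of a fewnomial: `(Σ cₗ X^{dₗ})(x) = Σ cₗ x^{dₗ}` — the functional `c` applied to the moment point `γ(x)`. [folklore] -/
theorem eval_fewnomial {K : ℕ} (c : Fin K → ℝ) (d : Fin K → ℕ) (x : ℝ) :
    (∑ l, C (c l) * (X : ℝ[X]) ^ d l).eval x = ∑ l, c l * x ^ d l := by
  simp [eval_finsetSum]

/-- Euler derivative of a fewnomial evaluated: `x·(Σ cₗ X^{dₗ})′(x) = Σ cₗ dₗ x^{dₗ}` — the functional `c` applied to the Euler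
tangent `θγ(x)`. [folklore] -/
theorem mul_eval_derivative_fewnomial {K : ℕ} (c : Fin K → ℝ) (d : Fin K → ℕ) (x : ℝ) :
    x * (derivative (∑ l, C (c l) * (X : ℝ[X]) ^ d l)).eval x = ∑ l, c l * d l * x ^ d l := by
  have h := congrArg (fun p => Polynomial.eval x p) (InflectionLaw.X_mul_derivative_fewnomial c d)
  simp only [eval_mul, eval_X] at h
  rw [h]
  simp [eval_finsetSum]

/-- **The tangent-line form of the dictionary** (lacunary moment curve).  For `x ≠ 0`, `x` is a zero of `X·W(u,v)` iff some
NONZERO functional `c = α·u + β·v` of the coefficient pencil annihilates both the moment point `γ(x) = (x^{dₗ})ₗ` and its Euler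
tangent `θγ(x) = (dₗ·x^{dₗ})ₗ` — i.e. the tangent line of `γ` at `x` meets `ker u ∩ ker v`; counting these `x > 0` is counting
the tangent lines of the convex arc `γ` that meet a fixed codimension-2 subspace [cite: SedykhShapiro2005, §1, the `k = 1`
developable]. [this work] -/
theorem X_mul_wronskian_fewnomial_eval_eq_zero_iff {K : ℕ} (u v : Fin K → ℝ) (d : Fin K → ℕ) {x : ℝ} (hx : x ≠ 0) :
    ((X : ℝ[X]) * wronskian (∑ l, C (u l) * X ^ d l) (∑ l, C (v l) * X ^ d l)).eval x = 0 ↔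
      ∃ c : ℝ × ℝ, c ≠ 0 ∧ (∑ l, (c.1 * u l + c.2 * v l) * x ^ d l = 0) ∧
        (∑ l, (c.1 * u l + c.2 * v l) * d l * x ^ d l = 0) := by
  rw [eval_mul, eval_X, mul_eq_zero, or_iff_right hx, wronskian_eval_eq_zero_iff_exists_double_root]
  refine exists_congr fun c => and_congr_right fun _ => ?_
  rw [pencil_fewnomial_eq, eval_fewnomial]
  refine and_congr_right fun _ => ?_
  rw [← mul_eval_derivative_fewnomial, mul_eq_zero, or_iff_right hx]

/-! ## §2 The plane, not the basis -/

/-- **`W(αu + βv, γu + δv) = (αδ − βγ)·W(u,v)`** — the Wronskian is a Plücker coordinate of the plane `span(u,v)`. [folklore] -/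
theorem wronskian_pencil_pencil (u v : ℝ[X]) (a b c d : ℝ) :
    wronskian (C a * u + C b * v) (C c * u + C d * v) = C (a * d - b * c) * wronskian u v := by
  simp only [wronskian, derivative_add, derivative_mul, derivative_C, zero_mul, zero_add, map_sub, map_mul]
  ring

/-- so a change of basis of the plane (`αδ − βγ ≠ 0`) does not change the root set of the Wronskian: `Z₊(W)` is an invariant of
the point `span(u,v)` of `Gr(2, K)` (dimension `2K − 4`, the conjectured bound). [folklore] -/
theorem roots_wronskian_pencil_pencil (u v : ℝ[X]) {a b c d : ℝ} (h : a * d - b * c ≠ 0) :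
    (wronskian (C a * u + C b * v) (C c * u + C d * v)).roots = (wronskian u v).roots := by
  rw [wronskian_pencil_pencil, roots_C_mul _ h]

/-! ## §3 Chambers where Conjecture W is a theorem -/

/-- **dense degree bound**: `deg u, deg v ≤ n ⇒ deg W(u,v) ≤ 2n − 2` (the `X^{2n−1}` coefficients `n·uₙvₙ − n·uₙvₙ` cancel).
[folklore] -/
theorem natDegree_wronskian_le_two_mul_sub_two (u v : ℝ[X]) {n : ℕ} (hu : u.natDegree ≤ n) (hv : v.natDegree ≤ n) :
    (wronskian u v).natDegree ≤ 2 * n - 2 := by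
  rcases Nat.eq_zero_or_pos n with hn | hn
  · subst hn
    have hu0 : u = C (u.coeff 0) := eq_C_of_natDegree_le_zero hu
    have hv0 : v = C (v.coeff 0) := eq_C_of_natDegree_le_zero hv
    rw [hu0, hv0]
    simp [wronskian]
  have hdu : (derivative u).natDegree ≤ n - 1 := (natDegree_derivative_le u).trans (Nat.sub_le_sub_right hu 1)
  have hdv : (derivative v).natDegree ≤ n - 1 := (natDegree_derivative_le v).trans (Nat.sub_le_sub_right hv 1)
  have h1 : (u * derivative v).natDegree ≤ n + (n - 1) := natDegree_mul_le_of_le hu hdv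
  have h2 : (derivative u * v).natDegree ≤ (n - 1) + n := natDegree_mul_le_of_le hdu hv
  have h2' : (derivative u * v).natDegree ≤ n + (n - 1) := h2.trans (le_of_eq (by omega))
  have hW : (wronskian u v).natDegree ≤ 2 * n - 1 := by
    have := natDegree_sub_le_of_le h1 h2'
    simpa [wronskian, show n + (n - 1) = 2 * n - 1 by omega] using this
  have hcoeff : (wronskian u v).coeff (2 * n - 1) = 0 := by
    have e1 : (u * derivative v).coeff (n + (n - 1)) = u.coeff n * (derivative v).coeff (n - 1) :=
      coeff_mul_add_eq_of_natDegree_le hu hdv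
    have e2 : (derivative u * v).coeff ((n - 1) + n) = (derivative u).coeff (n - 1) * v.coeff n :=
      coeff_mul_add_eq_of_natDegree_le hdu hv
    have e3 : (derivative v).coeff (n - 1) = v.coeff n * ((n - 1 : ℕ) + 1) := by
      rw [coeff_derivative, Nat.sub_add_cancel hn]
    have e4 : (derivative u).coeff (n - 1) = u.coeff n * ((n - 1 : ℕ) + 1) := by
      rw [coeff_derivative, Nat.sub_add_cancel hn]
    have eq1 : n + (n - 1) = 2 * n - 1 := by omega
    have eq2 : (n - 1) + n = 2 * n - 1 := by omega
    rw [eq1] at e1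
    rw [eq2] at e2
    simp only [wronskian, coeff_sub, e1, e2, e3, e4]
    ring
  refine (natDegree_le_iff_coeff_eq_zero).mpr fun N hN => ?_
  rcases Nat.lt_or_ge N (2 * n) with hlt | hge
  · have hN' : N = 2 * n - 1 := by omega
    rw [hN']; exact hcoeff
  · exact coeff_eq_zero_of_natDegree_lt (lt_of_le_of_lt hW (by omega))

/-- hence at most `2n − 2` distinct real roots (for `W(u,v) = 0` the root multiset is empty by convention). [folklore] -/
theorem card_roots_toFinset_wronskian_le (u v : ℝ[X]) {n : ℕ} (hu : u.natDegree ≤ n) (hv : v.natDegree ≤ n) :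
    (wronskian u v).roots.toFinset.card ≤ 2 * n - 2 :=
  (Multiset.toFinset_card_le _).trans ((card_roots' _).trans (natDegree_wronskian_le_two_mul_sub_two u v hu hv))

/-- a `K`-nomial on the dense support `dₗ = l` has degree `≤ K − 1`. [folklore] -/
theorem natDegree_dense_le {K : ℕ} (u : Fin K → ℝ) :
    (∑ l : Fin K, C (u l) * (X : ℝ[X]) ^ (l : ℕ)).natDegree ≤ K - 1 := by
  refine (natDegree_sum_le_of_forall_le _ _ fun l _ => ?_)
  exact (natDegree_C_mul_X_pow_le (u l) l).trans (by omega)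

/-- **Conjecture W in the DENSE chamber**: on the support `{0, 1, …, K−1}` two real `K`-nomials have `Z₊(W(u,v)) ≤ 2K − 4`
(indeed at most `2K − 4` real roots in all). [folklore degree count; the chamber statement this work] -/
theorem card_posRoots_wronskian_dense_le {K : ℕ} (u v : Fin K → ℝ) :
    ((wronskian (∑ l : Fin K, C (u l) * (X : ℝ[X]) ^ (l : ℕ)) (∑ l : Fin K, C (v l) * (X : ℝ[X]) ^ (l : ℕ))).roots.toFinset.filter
      (fun x => 0 < x)).card ≤ 2 * K - 4 := by
  refine (Finset.card_filter_le _ _).trans ?_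
  refine (card_roots_toFinset_wronskian_le _ _ (natDegree_dense_le u) (natDegree_dense_le v)).trans ?_
  omega

/-- `W(f·p, f·q) = f²·W(p,q)`. [folklore] -/
theorem wronskian_mul_mul (f p q : ℝ[X]) : wronskian (f * p) (f * q) = f ^ 2 * wronskian p q := by
  simp only [wronskian, derivative_mul]
  ring

/-- chain rule: `W(p ∘ g, q ∘ g) = g′ · (W(p,q) ∘ g)`. [folklore; Mathlib `derivative_comp`] -/
theorem wronskian_comp (p q g : ℝ[X]) : wronskian (p.comp g) (q.comp g) = derivative g * (wronskian p q).comp g := by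
  simp only [wronskian, derivative_comp, sub_comp, mul_comp]
  ring

/-- a fewnomial on the ARITHMETIC support `dₗ = e + λ·l` is `X^e · ũ(X^λ)` with `ũ` the dense fewnomial of the same coefficients.
[folklore] -/
theorem fewnomial_arith_eq {K : ℕ} (u : Fin K → ℝ) (e lam : ℕ) :
    (∑ l : Fin K, C (u l) * (X : ℝ[X]) ^ (e + lam * (l : ℕ))) =
      X ^ e * (∑ l : Fin K, C (u l) * (X : ℝ[X]) ^ (l : ℕ)).comp (X ^ lam) := by
  rw [Polynomial.sum_comp, Finset.mul_sum]
  refine Finset.sum_congr rfl fun l _ => ?_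
  rw [mul_comp, C_comp, X_pow_comp, pow_add, pow_mul]
  ring

/-- **Conjecture W in the ARITHMETIC chambers**: on a support `dₗ = e + λ·l` (`λ ≥ 1`) two real `K`-nomials have
`Z₊(W(u,v)) ≤ 2K − 4` (`X·W(u,v) = λ·X^{2e+λ}·W(ũ,ṽ)(X^λ)` and `x ↦ x^λ` is injective on `(0,∞)`). [this work] -/
theorem card_posRoots_wronskian_arith_le {K : ℕ} (u v : Fin K → ℝ) (e lam : ℕ) (hlam : 0 < lam) :
    ((wronskian (∑ l : Fin K, C (u l) * (X : ℝ[X]) ^ (e + lam * (l : ℕ)))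
        (∑ l : Fin K, C (v l) * (X : ℝ[X]) ^ (e + lam * (l : ℕ)))).roots.toFinset.filter (fun x => 0 < x)).card ≤ 2 * K - 4 := by
  set ud : ℝ[X] := ∑ l : Fin K, C (u l) * (X : ℝ[X]) ^ (l : ℕ) with hud
  set vd : ℝ[X] := ∑ l : Fin K, C (v l) * (X : ℝ[X]) ^ (l : ℕ) with hvd
  rw [fewnomial_arith_eq u e lam, fewnomial_arith_eq v e lam, wronskian_mul_mul, wronskian_comp]
  set W : ℝ[X] := wronskian ud vd with hWdef
  -- the positive roots of `(X^e)^2 · ((X^λ)′ · W(X^λ))` map injectively into those of `W` under `x ↦ x^λ`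
  have hbound := card_posRoots_wronskian_dense_le u v
  rw [← hud, ← hvd, ← hWdef] at hbound
  by_cases hW0 : W = 0
  · simp [hW0]
  have hmaps : ∀ x ∈ (((X : ℝ[X]) ^ e) ^ 2 * (derivative ((X : ℝ[X]) ^ lam) * W.comp (X ^ lam))).roots.toFinset.filter
      (fun x => 0 < x), x ^ lam ∈ W.roots.toFinset.filter (fun x => 0 < x) := by
    intro x hx
    rw [Finset.mem_filter, Multiset.mem_toFinset] at hx ⊢
    obtain ⟨hxr, hxpos⟩ := hx
    obtain ⟨-, hroot⟩ := mem_roots'.mp hxr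
    simp only [IsRoot, eval_mul, eval_pow, eval_X, eval_comp, derivative_X_pow, eval_C] at hroot
    have hxne : x ≠ 0 := ne_of_gt hxpos
    have h1 : (x ^ e) ^ 2 ≠ 0 := pow_ne_zero _ (pow_ne_zero _ hxne)
    have h2 : (lam : ℝ) * x ^ (lam - 1) ≠ 0 := mul_ne_zero (Nat.cast_ne_zero.mpr hlam.ne') (pow_ne_zero _ hxne)
    have hWx : W.eval (x ^ lam) = 0 := by
      rcases mul_eq_zero.mp hroot with h | h
      · exact absurd h h1
      · rcases mul_eq_zero.mp h with h' | h'
        · exact absurd h' h2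
        · exact h'
    exact ⟨(mem_roots hW0).mpr hWx, pow_pos hxpos lam⟩
  have hinj : Set.InjOn (fun x : ℝ => x ^ lam)
      ((((X : ℝ[X]) ^ e) ^ 2 * (derivative ((X : ℝ[X]) ^ lam) * W.comp (X ^ lam))).roots.toFinset.filter
        (fun x => 0 < x) : Set ℝ) := by
    intro x hx y hy hxy
    rw [Finset.coe_filter, Set.mem_setOf_eq] at hx hy
    exact (pow_left_strictMonoOn₀ hlam.ne').injOn hx.2.le hy.2.le hxy
  exact (Finset.card_le_card_of_injOn _ hmaps hinj).trans hbound

/-- **Conjecture W for `K ≤ 3`**: the rank-one Descartes ceiling `C(K,2) − 1` (`…InflectionLawSizeOne`) is `2K − 4` there.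
[this work] -/
theorem card_posRoots_wronskian_fewnomial_le_of_le_three {K : ℕ} (hK : K ≤ 3) (u v : Fin K → ℝ) (d : Fin K → ℕ) :
    ((wronskian (∑ l, C (u l) * X ^ d l) (∑ l, C (v l) * X ^ d l)).roots.toFinset.filter (fun x => 0 < x)).card ≤
      2 * K - 4 := by
  refine (InflectionLaw.card_posRoots_wronskian_fewnomial_le_choose u v d).trans ?_
  interval_cases K <;> simp [Nat.choose]

/-! ## §4 The sumset chamber: `Z₊(W(u,v)) ≤ #{dₐ + d_b : a < b} − 1` -/

/-- the restricted SUMSET `d ∔ d = {dₐ + d_b : a < b}` of a support, as a finset. (local abbreviation-free form) -/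
theorem mem_pairSums_iff {K : ℕ} (d : Fin K → ℕ) (n : ℕ) :
    n ∈ ((Finset.univ : Finset (Fin K × Fin K)).filter (fun p => p.1 < p.2)).image (fun p => d p.1 + d p.2) ↔
      ∃ a b : Fin K, a < b ∧ d a + d b = n := by
  simp only [Finset.mem_image, Finset.mem_filter, Finset.mem_univ, true_and, Prod.exists]

/-- **the support of `X·W(u,v)` lies in the restricted sumset** `{dₐ + d_b : a < b}` (pair-sum form; the diagonal `a = b` carries the
coefficient `uₐvₐ(dₐ − dₐ) = 0`). [this work] -/
theorem support_X_mul_wronskian_subset_pairSums {K : ℕ} (u v : Fin K → ℝ) (d : Fin K → ℕ) :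
    ((X : ℝ[X]) * wronskian (∑ l, C (u l) * X ^ d l) (∑ l, C (v l) * X ^ d l)).support ⊆
      ((Finset.univ : Finset (Fin K × Fin K)).filter (fun p => p.1 < p.2)).image (fun p => d p.1 + d p.2) := by
  intro n hn
  rw [mem_support_iff, InflectionLaw.X_mul_wronskian_fewnomial_eq, finsetSum_coeff] at hn
  simp only [finsetSum_coeff, coeff_C_mul_X_pow] at hn
  by_contra hmem
  apply hn
  refine Finset.sum_eq_zero fun a _ => Finset.sum_eq_zero fun b _ => ?_
  split_ifs with h
  · rcases lt_trichotomy a b with hab | hab | hab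
    · exact absurd ((mem_pairSums_iff d n).mpr ⟨a, b, hab, h.symm⟩) hmem
    · subst hab; simp
    · exact absurd ((mem_pairSums_iff d n).mpr ⟨b, a, hab, by rw [add_comm]; exact h.symm⟩) hmem
  · rfl

/-- **THE SUMSET CHAMBER**: `Z₊(W(u,v)) ≤ #(d ∔ d) − 1` (Descartes on the pair-sum form).  For a generic (Sidon) support this is the
rank-one ceiling `C(K,2) − 1`; it equals the conjectured `2K − 4` exactly when `#(d ∔ d) ≤ 2K − 3`, e.g. on ARITHMETIC PROGRESSIONS
(`#(d ∔ d) = 2K − 3`, the Freiman-minimal value) and on every BALANCED `4`-support `d₀ + d₃ = d₁ + d₂`. [this work] -/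
theorem card_posRoots_wronskian_le_card_pairSums_sub_one {K : ℕ} (u v : Fin K → ℝ) (d : Fin K → ℕ) :
    ((wronskian (∑ l, C (u l) * X ^ d l) (∑ l, C (v l) * X ^ d l)).roots.toFinset.filter (fun x => 0 < x)).card ≤
      (((Finset.univ : Finset (Fin K × Fin K)).filter (fun p => p.1 < p.2)).image (fun p => d p.1 + d p.2)).card - 1 := by
  rw [← InflectionLaw.card_posRoots_X_mul]
  refine (LacunarySymmetroidMatrixDescartes.FiniteSector.card_posRoots_le_card_support_sub_one _).trans ?_
  exact Nat.sub_le_sub_right (Finset.card_le_card (support_X_mul_wronskian_subset_pairSums u v d)) 1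

/-- **Conjecture W on BALANCED `4`-supports** (`d₀ + d₃ = d₁ + d₂`, e.g. `(0,1,3,4)`, `(0,2,5,7)`; not only arithmetic
progressions): `Z₊(W(u,v)) ≤ 4 = 2K − 4`, because two of the six pair sums coincide.  The first support on which Conjecture W is
not decided by Descartes is therefore an UNBALANCED `4`-support (e.g. the `2`-tower `(0,1,3,20)`: six distinct pair sums, ceiling `5`).
[this work] -/
theorem card_posRoots_wronskian_le_four_of_balanced (u v : Fin 4 → ℝ) (d : Fin 4 → ℕ) (hbal : d 0 + d 3 = d 1 + d 2) :
    ((wronskian (∑ l, C (u l) * X ^ d l) (∑ l, C (v l) * X ^ d l)).roots.toFinset.filter (fun x => 0 < x)).card ≤ 4 := by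
  refine (card_posRoots_wronskian_le_card_pairSums_sub_one u v d).trans ?_
  have hsub : ((Finset.univ : Finset (Fin 4 × Fin 4)).filter (fun p => p.1 < p.2)).image (fun p => d p.1 + d p.2) ⊆
      ({d 0 + d 1, d 0 + d 2, d 0 + d 3, d 1 + d 3, d 2 + d 3} : Finset ℕ) := by
    intro n hn
    obtain ⟨a, b, hab, rfl⟩ := (mem_pairSums_iff d n).mp hn
    simp only [Finset.mem_insert, Finset.mem_singleton]
    fin_cases a <;> fin_cases b <;> dsimp only at hab ⊢ <;>
      first
        | exact absurd hab (by decide)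
        | (simp; done)
        | exact Or.inr (Or.inr (Or.inl hbal.symm))
  have hcard : (({d 0 + d 1, d 0 + d 2, d 0 + d 3, d 1 + d 3, d 2 + d 3} : Finset ℕ)).card ≤ 5 := Finset.card_le_five
  have := (Finset.card_le_card hsub).trans hcard
  omega

/-! ## §5 The Euler pencil (size-one inflections) -/

/-- **size-one inflections as double roots of the EULER PENCIL.**  For a fewnomial `g = Σ sₗ X^{dₗ}` and `x ≠ 0`: `x` is a zero of
`X·W(g, θg)` (`θ = X·d/dX`; the size-one inflection polynomial of `…InflectionLawSizeOne`) iff some nonzero member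
`α·g + β·θg = Σ sₗ(α + β dₗ) X^{dₗ}` of the Euler pencil — a fewnomial on the SAME support whose coefficient signs flip one exponent
at a time as `−α/β` sweeps — is annihilated at `x` together with its Euler derivative. [this work] -/
theorem X_mul_inflection_one_eval_eq_zero_iff {K : ℕ} (s : Fin K → ℝ) (d : Fin K → ℕ) {x : ℝ} (hx : x ≠ 0) :
    ((X : ℝ[X]) * wronskian (∑ l, C (s l) * X ^ d l) (∑ l, C (s l * d l) * X ^ d l)).eval x = 0 ↔
      ∃ c : ℝ × ℝ, c ≠ 0 ∧ (∑ l, (c.1 * s l + c.2 * (s l * d l)) * x ^ d l = 0) ∧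
        (∑ l, (c.1 * s l + c.2 * (s l * d l)) * d l * x ^ d l = 0) :=
  X_mul_wronskian_fewnomial_eval_eq_zero_iff s (fun l => s l * d l) d hx

/-- and `θg` IS the fewnomial with coefficients `sₗ dₗ` (so the previous lemma is about `W(g, θg)` verbatim). [tree:
`InflectionLaw.X_mul_derivative_fewnomial`] -/
theorem euler_fewnomial_eq {K : ℕ} (s : Fin K → ℝ) (d : Fin K → ℕ) :
    (X : ℝ[X]) * derivative (∑ l, C (s l) * X ^ d l) = ∑ l, C (s l * d l) * (X : ℝ[X]) ^ d l :=
  InflectionLaw.X_mul_derivative_fewnomial s d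

end WronskianDevelopable

end Summit.ValiantsHypothesis.ValiantsHypothesis.Theorems.KPlusLogSqLaw.TowerGraft
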